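import Summits.BirchSwinnertonDyer.Rank1Residual.X11b.BDPRouteOpenInputFieldClassRecord
import HarnessLib

/-!
# Class X11b, route p2 at `p ≥ 5`: THE END-STATE CLASS RECORD — `∀ (E,p) ∈ X11b, p ≥ 5 → BSD(E,p)`
# from the published facts, (2.4)∃♭ over ONE admissible Heegner field per surjective pair (value
# over that field only off the semistable pairs), NOTHING per pair on the Locus (92.3 % of the
# class-wide shape), ONE certificate per pair off it (REG where `p ∣ ∏c`, a twist certificate where
# `p ∤ ∏c`), the exceptional conjecture on 334 pairs and the corner on 64 (cell `b2b-bsdres`,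
# sub-cell `multr1-p2`, gen 27; file 6)

HONEST FRAMING (cell `b2b-bsdres`, run/shared/lean/b2b/bsd-rank1-residual/, verbatim in every
file): the goal of the cell is to DELETE the COMBINATION-SHAPED residual classes of the
Birch–Swinnerton-Dyer formula for ALL analytic-rank `≤ 1` elliptic curves over `ℚ` — "full BSD
formula for every rank `≤ 1` curve in class `C`" assembled STRICTLY from published theorems — so
that the rank-`≤ 1` remainder becomes exactly the CONSTRUCTION-SHAPED classes, which are TYPED
(missing-input `Prop`s), NOT attempted. This is not "finishing BSD". Sub-cell `multr1-p2` is a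
RESEARCH ROUTE on class X11b (`ClassX11b W p := r_an = 1 ∧ p ≠ 2 ∧ mult(p) ∧ irr(p)`); no claim
beyond the stated class and loci; X11b's label does not change; NOTHING is booked by this file.

THEOREMS ONLY (no definition, no named fact, no `sorry`).

## Why

The cell's class-level records since gen 21 (`P2.bsdp_of_onTree_cyclotomic`, `…_twistCertificate`,
gen 24's `…_intFrame`, gen 25's `…_split`, file 5's `…_someFramesAtField`) ask the `p`-adic height
certificate (REG) at EVERY pair, because they route every surjective pair through the cyclotomic
lever; the per-atom END STATES (gen 18 `P2.bsdp_of_locus_endState`, gens 23–27 semistable end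
states) ask NOTHING per pair on the Locus (`(ram) ∧ p ∤ ∏_ℓ c_ℓ(E)`: the Euler-system half is the
THEOREM `missingUpperBoundAt_of_classX11b_of_ram_of_not_dvd` — Kolyvagin 1990 + Gross–Zagier +
Skinner 2016 Thm. C). This file puts the two together at class level, over the per-field input of
gen 27.

## What this file proves

* **`P2.bsdp_of_onTree_endState_of_lowerHalf`** — `∀ (E,p) ∈` X11b, `p ≥ 5 → BSD(E,p)` from the
  published facts (route p2's, the lever's, Kolyvagin 1990 Thm. A, Skinner 2016 Thm. C, BDMTV) and
  the typed inputs: (T1′) the main-conjecture half `Typed.MissingLowerBoundAt` on the surjective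
  pairs; **(REG) ONLY on the surjective pairs with `p ∣ ∏_ℓ c_ℓ(E)`** (class-wide, `N < 5·10⁵`:
  (ram) ∧ `p ∣ ∏c` 61 998 + ¬(ram) ∧ surj ∧ `p ∣ ∏c` 2 092 = 64 090 pairs, 2.8 %); **(TC) one twist
  certificate on the ¬(ram) ∧ surj pairs with `p ∤ ∏c`** (110 083 pairs, 4.9 % — every one of them
  carries a certificate in gen 22's census, kit jobs j126194/j126493/j128113); (T2∗′) the
  conjecture `RelativeExceptionalLeadingTermAt` on split-only ∧ `p ∣ ∏c` pairs (334); (T4′) the corner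
  (64). On the Locus (2 093 111 pairs, 92.3 %) NOTHING per pair. Dispatch: ¬surj → corner; Locus →
  the theorem; `p ∣ ∏c` → lever + REG (the (ram) prime or a second multiplicative prime gives
  Disegni's (∗); split-only → the conjecture road); ¬(ram) ∧ `p ∤ ∏c` → the twist certificate.
* **`P2.bsdp_of_onTree_endStateAtField`** — THE END-STATE CLASS RECORD OVER ONE FIELD PER PAIR: as
  above with (T1′) supplied, per surjective pair, by ONE admissible Heegner field `K` carrying
  (2.4)∃♭ over `K` (THE open statement) and — only when the pair is NOT semistable — value∃♭ over
  `K` (PUB shape; `h32` on semistable pairs).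
* **`P2.bsdp_of_onTree_endState_prescribedFields`** — the same with (2.4)∃♭ (+ value off semistable)
  asked over the Hoffstein–Luo fields with a class-wide prescribed finite split set `S`,
  `d_K ≡ 1 (mod 8)`, `|d_K| > B`.

CONDITIONAL on the typed inputs ((2.4): PRE at `p ∥ N`; value: PUB shape off the semistable pairs;
REG / TC per pair where said; the conjecture; the corner); nothing booked; labels UNCHANGED; X11b
stays CONSTRUCTION-SHAPED.

## References

* [Castella2018] Thms. 2.3, 3.1, 3.2, §5 (arXiv:1704.06608 pp. 5, 9, 12). * [Castella2018Erratum] (2.4).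
* [McCallumLMS1991] §1 Theorem (Kolyvagin), p. 296. * [Skinner2016PacificMC] Thm. C (§1).
* [Disegni2020] Thm. 1 (§1.2), Thm. 4, (∗). * [Wuthrich2014] Thm. 3 (p. 383), Prop. 21 (p. 400).
* [SteinWuthrich2013] Thm. 6.1, §4.2. * [BalakrishnanEtAl2019] Thm. 1.2. * [HoffsteinLuo1997] Theorem.
* [Miller2011LMS] Def. 1.1.
-/

noncomputable section

open scoped Classical NumberField

open WeierstrassCurve NumberField IsDedekindDomain Field
open Literature.NumberTheory.EllipticCurves Literature.NumberTheory.EllipticCurves.GreenbergSelmer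
  Literature.NumberTheory.EllipticCurves.ModularForms
  Literature.NumberTheory.EllipticCurves.Rank1Residual
  Literature.NumberTheory.EllipticCurves.Rank1Residual.Typed
  Literature.NumberTheory.EllipticCurves.Wuthrich2014
  Literature.NumberTheory.EllipticCurves.Castella2018
  Literature.NumberTheory.EllipticCurves.SteinWuthrich2013
  Literature.NumberTheory.EllipticCurves.Disegni2020
  Literature.NumberTheory.EllipticCurves.Skinner2016
  Literature.NumberTheory.EllipticCurves.BalakrishnanEtAl2019
  Literature.NumberTheory.EllipticCurves.KrizLi2019
  Literature.NumberTheory.QuadraticFields.Quadratic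
  Literature.NumberTheory.Automorphic
  Literature.NumberTheory.GaloisRepresentations Literature.NumberTheory.GaloisCohomology

namespace Summit.BirchSwinnertonDyer.Rank1Residual.X11b

/-! ### §1 The end-state class record with the main-conjecture half abstracted -/

/-- **END-STATE CLASS RECORD, main-conjecture half abstracted.** See the module docstring: (T1′) on
the surjective pairs; NOTHING per pair on the Locus; (REG) only where `p ∣ ∏c`; (TC) on ¬(ram) ∧
`p ∤ ∏c`; the conjecture on split-only ∧ `p ∣ ∏c`; the corner. CONDITIONAL; nothing booked.
[cite: McCallumLMS1991, §1 Theorem (Kolyvagin), p. 296] [cite: Skinner2016PacificMC, Thm. C (§1)]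
[cite: Wuthrich2014, Thm. 3 (p. 383), Prop. 21 (p. 400)] [cite: SteinWuthrich2013, Thm. 6.1, §4.2]
[cite: Disegni2020, Thm. 1 (§1.2), (∗)] [cite: BalakrishnanEtAl2019, Thm. 1.2] [cite: Miller2011LMS, Def. 1.1] -/
theorem P2.bsdp_of_onTree_endState_of_lowerHalf
    -- route p2's published inputs
    (hGZ : ∀ (N : ℕ) [NeZero N] (W : WeierstrassCurve ℚ) (K : Type) [Field K] [NumberField K],
      gross_zagier N W K)
    (hKo : ∀ (N : ℕ) [NeZero N] (W : WeierstrassCurve ℚ) (K : Type) [Field K] [NumberField K],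
      kolyvagin N W K)
    (hB : ∀ (N : ℕ) [NeZero N] (W : WeierstrassCurve ℚ) (K : Type) [Field K] [NumberField K],
      Kolyvagin1990_padicValNat_card_sha_le N W K)
    (hSk : Skinner2016.thmC_padicValRat_bsd_rank_zero)
    (hGZK : rank_eq_analyticRank_of_analyticRank_le_one) (hmod : hasEntireLFunction_rat)
    (hnf : exists_isNewformOf) (hHL : HoffsteinLuo1997_exists_twist_L_one_ne_zero)
    (hMaz : mazur_not_dvd_maninConstant_of_odd) (hBDMTV : thm12_not_le_normalizer_splitCartan)
    -- the lever's published inputs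
    (hK : kato_charIdeal_dvd_multiplicative_of_surjective)
    (hJn : thm61_nonsplitMultiplicative) (hJs : thm61_splitMultiplicative)
    (hHn : exists_isMultCanonical) (hHs : exists_isSplitMultCanonical)
    (hD : thm1_padicBSD_rankOne_multiplicative) (hpar : nonempty_modularParametrizationData)
    -- (T1′) the main-conjecture half on the surjective pairs
    (hLow : ∀ (W : WeierstrassCurve ℚ) [W.IsElliptic] [W.IsGloballyMinimal] (p : ℕ) [Fact p.Prime],
      ClassX11b W p → 5 ≤ p → Surj W p → Typed.MissingLowerBoundAt W p)
    -- (REG) ONLY where `p ∣ ∏_ℓ c_ℓ(E)`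
    (hReg : ∀ (W : WeierstrassCurve ℚ) [W.IsElliptic] [W.IsGloballyMinimal] (p : ℕ) [Fact p.Prime],
      ClassX11b W p → 5 ≤ p → Surj W p → p ∣ W.tamagawaProduct →
      ClassClosure.RegulatorNonvanishingAt W p)
    -- (TC) ONE twist certificate per ¬(ram) ∧ surj pair with `p ∤ ∏c`
    (hTC : ∀ (W : WeierstrassCurve ℚ) [W.IsElliptic] [W.IsGloballyMinimal] (p : ℕ) [Fact p.Prime],
      ClassX11b W p → 5 ≤ p → Surj W p → ¬ Ram W p → ¬ p ∣ W.tamagawaProduct →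
      ∃ (K : Type) (_ : Field K) (_ : NumberField K) (Wd : WeierstrassCurve ℚ) (_ : Wd.IsElliptic)
        (_ : Wd.IsGloballyMinimal) (Cd : VariableChange ℚ) (qd : ℚ),
        IsImaginaryQuadratic K ∧ SatisfiesHeegnerHypothesis (W.conductorNorm ℤ) K ∧
        NumberField.discr K < -4 ∧ Cd • W.quadraticTwist (NumberField.discr K : ℚ) = Wd ∧
        Wd.entireLFunction 1 / (Wd.realPeriodRat : ℂ) = (qd : ℂ) ∧ qd ≠ 0 ∧ padicValRat p qd = 0)
    -- (T2∗′) the exceptional conjecture, only on split-only pairs with `p ∣ ∏c`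
    (hC : ∀ (W : WeierstrassCurve ℚ) [W.IsElliptic] [W.IsGloballyMinimal] (p : ℕ) [Fact p.Prime],
      ClassX11b W p → 5 ≤ p → W.HasSplitMultiplicativeReductionAtPrime p →
      (¬ ∃ (m : ℕ) (_ : Fact m.Prime), m ≠ p ∧ W.HasMultiplicativeReductionAtPrime m) →
      p ∣ W.tamagawaProduct → ClassClosure.RelativeExceptionalLeadingTermAt W p)
    -- (T4′)
    (hCorner : ∀ (W : WeierstrassCurve ℚ) [W.IsElliptic] [W.IsGloballyMinimal] (p : ℕ)
      [Fact p.Prime], ClassX11b W p → ¬ Surj W p → (p = 5 ∨ p = 7) →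
        p ∣ padicValInt p W.minimalDiscriminantInt → ¬ Ram W p → Typed.MissingPPartAt W p)
    (W : WeierstrassCurve ℚ) [W.IsElliptic] [W.IsGloballyMinimal] (p : ℕ) [Fact p.Prime]
    (hX : ClassX11b W p) (hp5 : 5 ≤ p) : BSDp W p := by
  have hp2 : p ≠ 2 := hX.2.1
  by_cases hsurj : Surj W p
  · refine Typed.bsdp_of_missingPPartAt W p hGZK (by rw [hX.1])
      (Typed.missingPPartAt_of_lower_of_upper W p (hLow W p hX hp5 hsurj) ?_)
    -- the Euler-system half
    by_cases htam : p ∣ W.tamagawaProduct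
    · -- `p ∣ ∏c`: the cyclotomic lever with (REG)
      by_cases hst : W.HasSplitMultiplicativeReductionAtPrime p →
          ∃ (m : ℕ) (_ : Fact m.Prime), m ≠ p ∧ W.HasMultiplicativeReductionAtPrime m
      · exact missingUpperBoundAt_of_katoSurj_of_regulatorNonvanishing W p hK hJn hJs hHn hHs hD hGZK
          hpar hp5 hX.2.2.1 hX.1 hsurj hst (hReg W p hX hp5 hsurj htam)
      · rw [Classical.not_imp] at hst
        obtain ⟨hsplit, hm⟩ := hst
        exact missingUpperBoundAt_of_katoSurj_split_of_relativeLeadingTerm W p hK hJs hHs hGZK hpar hp2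
          hX.2.2.1 hsplit hX.1
          (kato_charIdeal_dvd_multiplicative_of_surjective.surjective_pow_of_five_le W p hp5 hsurj)
          (hC W p hX hp5 hsplit hm htam) (hReg W p hX hp5 hsurj htam).2
    · by_cases hram : Ram W p
      · -- the Locus: the THEOREM (Kolyvagin 1990 + Gross–Zagier + Skinner Thm. C)
        exact missingUpperBoundAt_of_classX11b_of_ram_of_not_dvd hGZ hKo hB hSk hGZK hmod hnf hHL hMaz
          integral_neronScaling_of_isGloballyMinimal_holds W p hX hram htam
      · -- ¬(ram) ∧ `p ∤ ∏c`: the twist certificate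
        obtain ⟨K, _, _, Wd, _, _, Cd, qd, hK', hHN, hdK, hWd, hqd, hqd0, hvd⟩ :=
          hTC W p hX hp5 hsurj hram htam
        exact missingUpperBoundAt_of_classX11b_of_twistUnit W p hGZ hKo hB hGZK hmod hnf hMaz hX hp5
          hsurj htam K hK' hHN hdK Wd Cd hWd qd hqd hqd0 hvd
  · -- the non-surjective corner, localised
    obtain ⟨h57, hdvd, hnram⟩ := ClassX11b.not_surj_shape W p hBDMTV hX hp5 hsurj
    exact Typed.bsdp_of_missingPPartAt W p hGZK (by rw [hX.1]) (hCorner W p hX hsurj h57 hdvd hnram)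

/-! ### §2 The end-state class record over ONE field per pair -/

/-- **ROUTE p2 — THE END-STATE CLASS RECORD OVER ONE FIELD PER PAIR (gen 27).** `∀ (E, p) ∈`
X11b, `p ≥ 5 → BSD(E, p)` from route p2's and the lever's published named facts (+ Kolyvagin 1990
Thm. A, Skinner 2016 Thm. C, Cas18 Thms. 3.1–3.2 `h32`, BDMTV, Hoffstein–Luo), the cited
Poitou–Tate / local Euler characteristic, and the typed inputs: **(T1″) per surjective pair ONE
admissible Heegner field `K` (`d_K` odd, `p ∤ d_K`, `p ∤ w_K`, every `ℓ ∣ N_E` split,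
`L(E^{d_K},1) ≠ 0`) with (2.4)∃♭ over `K` — THE open statement — and, only when the pair is NOT
semistable, value∃♭ over `K`** (PUB shape); NOTHING per pair on the Locus (2 093 111 class-wide
pairs); **(REG) only on the 64 090 surjective pairs with `p ∣ ∏c`**; **(TC) on the 110 083 ¬(ram)
pairs with `p ∤ ∏c`** (all certified in gen 22's census); the conjecture on 334; the corner on 64.
§1 with (T1′) from files 1/3. CONDITIONAL; nothing booked; labels UNCHANGED; X11b stays
CONSTRUCTION-SHAPED. [cite: Castella2018Erratum, (2.4) (p. 4)] [cite: Castella2018, Thms. 2.3, 3.1, 3.2, §5]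
[cite: McCallumLMS1991, §1 Theorem (Kolyvagin), p. 296] [cite: Skinner2016PacificMC, Thm. C (§1)]
[cite: Disegni2020, Thm. 1 (§1.2), (∗)] [cite: Wuthrich2014, Thm. 3 (p. 383), Prop. 21 (p. 400)]
[cite: SteinWuthrich2013, Thm. 6.1, §4.2] [cite: BalakrishnanEtAl2019, Thm. 1.2] [cite: Miller2011LMS, Def. 1.1] -/
theorem P2.bsdp_of_onTree_endStateAtField
    -- route p2's published inputs
    (hGZ : ∀ (N : ℕ) [NeZero N] (W : WeierstrassCurve ℚ) (K : Type) [Field K] [NumberField K],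
      gross_zagier N W K)
    (hKo : ∀ (N : ℕ) [NeZero N] (W : WeierstrassCurve ℚ) (K : Type) [Field K] [NumberField K],
      kolyvagin N W K)
    (hB : ∀ (N : ℕ) [NeZero N] (W : WeierstrassCurve ℚ) (K : Type) [Field K] [NumberField K],
      Kolyvagin1990_padicValNat_card_sha_le N W K)
    (hSk : Skinner2016.thmC_padicValRat_bsd_rank_zero) (hWu : sha_dvd_analyticSha)
    (hGZK : rank_eq_analyticRank_of_analyticRank_le_one) (hnf : exists_isNewformOf)
    (hHL : HoffsteinLuo1997_exists_twist_L_one_ne_zero) (hMaz : mazur_not_dvd_maninConstant_of_odd)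
    (hBDMTV : thm12_not_le_normalizer_splitCartan)
    (hPT : ∀ (K : Type) [Field K] [NumberField K], poitouTate_sum_localTatePairing_eq_zero K)
    (hEP : ∀ (K : Type) [Field K] [NumberField K] (v : HeightOneSpectrum (𝓞 K)),
      localEulerPoincareCharacteristic (v.adicCompletion K))
    -- Castella 2018 Thms. 3.1–3.2 (PUBLISHED; semistable scope)
    (h32 : thm32_exists_isBDPLFunction_valueAtOne)
    -- the lever's published inputs
    (hK : kato_charIdeal_dvd_multiplicative_of_surjective)
    (hJn : thm61_nonsplitMultiplicative) (hJs : thm61_splitMultiplicative)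
    (hHn : exists_isMultCanonical) (hHs : exists_isSplitMultCanonical)
    (hD : thm1_padicBSD_rankOne_multiplicative) (hpar : nonempty_modularParametrizationData)
    -- (T1″) ONE admissible field per surjective pair, with (2.4)∃♭ over it (+ value off semistable)
    (hField : ∀ (W : WeierstrassCurve ℚ) [W.IsElliptic] [W.IsGloballyMinimal] (p : ℕ) [Fact p.Prime],
      ClassX11b W p → 5 ≤ p → Surj W p →
      ∃ (K : Type) (_ : Field K) (_ : NumberField K), IsImaginaryQuadratic K ∧
        Odd (NumberField.discr K) ∧ ¬ (p : ℤ) ∣ NumberField.discr K ∧ ¬ p ∣ Units.torsionOrder K ∧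
        SatisfiesHeegnerHypothesis (W.conductorNorm ℤ) K ∧
        (W.quadraticTwist (NumberField.discr K : ℚ)).entireLFunction 1 ≠ 0 ∧
        P2.IMCDivSomeFrameOnTreeAtField W p K ∧
        (¬ Semistable W → P2.BDPValueSomeFrameOnTreeAtField W p K))
    -- (REG) ONLY where `p ∣ ∏_ℓ c_ℓ(E)`
    (hReg : ∀ (W : WeierstrassCurve ℚ) [W.IsElliptic] [W.IsGloballyMinimal] (p : ℕ) [Fact p.Prime],
      ClassX11b W p → 5 ≤ p → Surj W p → p ∣ W.tamagawaProduct →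
      ClassClosure.RegulatorNonvanishingAt W p)
    -- (TC) ONE twist certificate per ¬(ram) ∧ surj pair with `p ∤ ∏c`
    (hTC : ∀ (W : WeierstrassCurve ℚ) [W.IsElliptic] [W.IsGloballyMinimal] (p : ℕ) [Fact p.Prime],
      ClassX11b W p → 5 ≤ p → Surj W p → ¬ Ram W p → ¬ p ∣ W.tamagawaProduct →
      ∃ (K : Type) (_ : Field K) (_ : NumberField K) (Wd : WeierstrassCurve ℚ) (_ : Wd.IsElliptic)
        (_ : Wd.IsGloballyMinimal) (Cd : VariableChange ℚ) (qd : ℚ),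
        IsImaginaryQuadratic K ∧ SatisfiesHeegnerHypothesis (W.conductorNorm ℤ) K ∧
        NumberField.discr K < -4 ∧ Cd • W.quadraticTwist (NumberField.discr K : ℚ) = Wd ∧
        Wd.entireLFunction 1 / (Wd.realPeriodRat : ℂ) = (qd : ℂ) ∧ qd ≠ 0 ∧ padicValRat p qd = 0)
    -- (T2∗′)
    (hC : ∀ (W : WeierstrassCurve ℚ) [W.IsElliptic] [W.IsGloballyMinimal] (p : ℕ) [Fact p.Prime],
      ClassX11b W p → 5 ≤ p → W.HasSplitMultiplicativeReductionAtPrime p →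
      (¬ ∃ (m : ℕ) (_ : Fact m.Prime), m ≠ p ∧ W.HasMultiplicativeReductionAtPrime m) →
      p ∣ W.tamagawaProduct → ClassClosure.RelativeExceptionalLeadingTermAt W p)
    -- (T4′)
    (hCorner : ∀ (W : WeierstrassCurve ℚ) [W.IsElliptic] [W.IsGloballyMinimal] (p : ℕ)
      [Fact p.Prime], ClassX11b W p → ¬ Surj W p → (p = 5 ∨ p = 7) →
        p ∣ padicValInt p W.minimalDiscriminantInt → ¬ Ram W p → Typed.MissingPPartAt W p)
    (W : WeierstrassCurve ℚ) [W.IsElliptic] [W.IsGloballyMinimal] (p : ℕ) [Fact p.Prime]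
    (hX : ClassX11b W p) (hp5 : 5 ≤ p) : BSDp W p := by
  have hmod : hasEntireLFunction_rat := hasEntireLFunction_rat_of_exists_isNewformOf hnf
  refine P2.bsdp_of_onTree_endState_of_lowerHalf hGZ hKo hB hSk hGZK hmod hnf hHL hMaz hBDMTV hK hJn hJs
    hHn hHs hD hpar ?_ hReg hTC hC hCorner W p hX hp5
  intro W _ _ p _ hX hp5 hsurj
  obtain ⟨K, _, _, hK', hodd, hpd, hμ, hHN, hLt, hDiv, hVal⟩ := hField W p hX hp5 hsurj
  have hV : P2.BDPValueSomeFrameOnTreeAtField W p K := by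
    by_cases hss : Semistable W
    · exact P2.bdpValueSomeFrameOnTreeAtField_of_thm32_of_semistable h32 hss
    · exact hVal hss
  exact P2.missingLowerBoundAt_of_openInputAtField W p hGZ hKo hWu hGZK hmod hnf hMaz hPT hEP hK' hodd
    hpd hμ hHN hLt (P2.openInputOnTreeAtField_of_someFrames hnf hGZK hKo hPT hEP hDiv hV) hX hp5 hsurj

/-- **ROUTE p2 — THE END-STATE CLASS RECORD OVER THE PRESCRIBED FIELDS (gen 27).** As above with
(T1″) replaced by: for a finite set `S` of primes and a bound `B` fixed for the class (a source's
hypotheses on the field), at every surjective pair (2.4)∃♭ over `K` (+ value∃♭ over `K` off the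
semistable pairs) for EVERY imaginary quadratic `K` with `d_K ≡ 1 (mod 8)`, `|d_K| > B`, the primes
of `S` split, every `ℓ ∣ N_E` and `p` split and `L(E^{d_K},1) ≠ 0`; Hoffstein–Luo supplies one such
field per pair (file 2). CONDITIONAL; nothing booked; labels UNCHANGED; X11b stays CONSTRUCTION-SHAPED.
[cite: HoffsteinLuo1997, Theorem] [cite: Castella2018Erratum, (2.4) (p. 4)] [cite: Castella2018, Thms. 3.1, 3.2, §5]
[cite: McCallumLMS1991, §1 Theorem (Kolyvagin), p. 296] [cite: Skinner2016PacificMC, Thm. C (§1)]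
[cite: Disegni2020, Thm. 1 (§1.2), (∗)] [cite: Wuthrich2014, Thm. 3 (p. 383), Prop. 21 (p. 400)]
[cite: BalakrishnanEtAl2019, Thm. 1.2] [cite: Miller2011LMS, Def. 1.1] -/
theorem P2.bsdp_of_onTree_endState_prescribedFields
    (hGZ : ∀ (N : ℕ) [NeZero N] (W : WeierstrassCurve ℚ) (K : Type) [Field K] [NumberField K],
      gross_zagier N W K)
    (hKo : ∀ (N : ℕ) [NeZero N] (W : WeierstrassCurve ℚ) (K : Type) [Field K] [NumberField K],
      kolyvagin N W K)
    (hB : ∀ (N : ℕ) [NeZero N] (W : WeierstrassCurve ℚ) (K : Type) [Field K] [NumberField K],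
      Kolyvagin1990_padicValNat_card_sha_le N W K)
    (hSk : Skinner2016.thmC_padicValRat_bsd_rank_zero) (hWu : sha_dvd_analyticSha)
    (hGZK : rank_eq_analyticRank_of_analyticRank_le_one) (hnf : exists_isNewformOf)
    (hHL : HoffsteinLuo1997_exists_twist_L_one_ne_zero) (hMaz : mazur_not_dvd_maninConstant_of_odd)
    (hBDMTV : thm12_not_le_normalizer_splitCartan)
    (hPT : ∀ (K : Type) [Field K] [NumberField K], poitouTate_sum_localTatePairing_eq_zero K)
    (hEP : ∀ (K : Type) [Field K] [NumberField K] (v : HeightOneSpectrum (𝓞 K)),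
      localEulerPoincareCharacteristic (v.adicCompletion K))
    (h32 : thm32_exists_isBDPLFunction_valueAtOne)
    (hK : kato_charIdeal_dvd_multiplicative_of_surjective)
    (hJn : thm61_nonsplitMultiplicative) (hJs : thm61_splitMultiplicative)
    (hHn : exists_isMultCanonical) (hHs : exists_isSplitMultCanonical)
    (hD : thm1_padicBSD_rankOne_multiplicative) (hpar : nonempty_modularParametrizationData)
    -- the source's hypotheses on the field, fixed for the class
    (S : Finset ℕ) (hS : ∀ q ∈ S, q.Prime) (B : ℕ)
    -- (T1‴) (2.4)∃♭ (+ value off semistable) over the prescribed fields, at every surjective pair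
    (hField : ∀ (W : WeierstrassCurve ℚ) [W.IsElliptic] [W.IsGloballyMinimal] (p : ℕ) [Fact p.Prime],
      ClassX11b W p → 5 ≤ p → Surj W p →
      ∀ (K : Type) [Field K] [NumberField K], IsImaginaryQuadratic K →
        NumberField.discr K % 8 = 1 → B < (NumberField.discr K).natAbs →
        (∀ q ∈ S, SatisfiesHeegnerHypothesis q K) →
        SatisfiesHeegnerHypothesis (W.conductorNorm ℤ) K → SatisfiesHeegnerHypothesis p K →
        (W.quadraticTwist (NumberField.discr K : ℚ)).entireLFunction 1 ≠ 0 →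
        P2.IMCDivSomeFrameOnTreeAtField W p K ∧
        (¬ Semistable W → P2.BDPValueSomeFrameOnTreeAtField W p K))
    (hReg : ∀ (W : WeierstrassCurve ℚ) [W.IsElliptic] [W.IsGloballyMinimal] (p : ℕ) [Fact p.Prime],
      ClassX11b W p → 5 ≤ p → Surj W p → p ∣ W.tamagawaProduct →
      ClassClosure.RegulatorNonvanishingAt W p)
    (hTC : ∀ (W : WeierstrassCurve ℚ) [W.IsElliptic] [W.IsGloballyMinimal] (p : ℕ) [Fact p.Prime],
      ClassX11b W p → 5 ≤ p → Surj W p → ¬ Ram W p → ¬ p ∣ W.tamagawaProduct →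
      ∃ (K : Type) (_ : Field K) (_ : NumberField K) (Wd : WeierstrassCurve ℚ) (_ : Wd.IsElliptic)
        (_ : Wd.IsGloballyMinimal) (Cd : VariableChange ℚ) (qd : ℚ),
        IsImaginaryQuadratic K ∧ SatisfiesHeegnerHypothesis (W.conductorNorm ℤ) K ∧
        NumberField.discr K < -4 ∧ Cd • W.quadraticTwist (NumberField.discr K : ℚ) = Wd ∧
        Wd.entireLFunction 1 / (Wd.realPeriodRat : ℂ) = (qd : ℂ) ∧ qd ≠ 0 ∧ padicValRat p qd = 0)
    (hC : ∀ (W : WeierstrassCurve ℚ) [W.IsElliptic] [W.IsGloballyMinimal] (p : ℕ) [Fact p.Prime],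
      ClassX11b W p → 5 ≤ p → W.HasSplitMultiplicativeReductionAtPrime p →
      (¬ ∃ (m : ℕ) (_ : Fact m.Prime), m ≠ p ∧ W.HasMultiplicativeReductionAtPrime m) →
      p ∣ W.tamagawaProduct → ClassClosure.RelativeExceptionalLeadingTermAt W p)
    (hCorner : ∀ (W : WeierstrassCurve ℚ) [W.IsElliptic] [W.IsGloballyMinimal] (p : ℕ)
      [Fact p.Prime], ClassX11b W p → ¬ Surj W p → (p = 5 ∨ p = 7) →
        p ∣ padicValInt p W.minimalDiscriminantInt → ¬ Ram W p → Typed.MissingPPartAt W p)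
    (W : WeierstrassCurve ℚ) [W.IsElliptic] [W.IsGloballyMinimal] (p : ℕ) [Fact p.Prime]
    (hX : ClassX11b W p) (hp5 : 5 ≤ p) : BSDp W p := by
  refine P2.bsdp_of_onTree_endStateAtField hGZ hKo hB hSk hWu hGZK hnf hHL hMaz hBDMTV hPT hEP h32 hK
    hJn hJs hHn hHs hD hpar ?_ hReg hTC hC hCorner W p hX hp5
  intro W _ _ p _ hX hp5 hsurj
  have hr : W.analyticRank = 1 := hX.1
  have hp2 : p ≠ 2 := hX.2.1
  have hw : W.rootNumber = -1 := by
    rw [WeierstrassCurve.rootNumber_eq_neg_one_pow_analyticRank_of_exists_isNewformOf hnf W, hr]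
    norm_num
  obtain ⟨K, _, _, hK', hd8, hBK, hHN, hHp, hHS, hLt⟩ :=
    exists_admissibleField_splitAt W p hnf hHL hw S hS (max B 4)
  have hB' : B < (NumberField.discr K).natAbs := lt_of_le_of_lt (le_max_left _ _) hBK
  have h4 : 4 < (NumberField.discr K).natAbs := lt_of_le_of_lt (le_max_right _ _) hBK
  obtain ⟨hodd, hpd, hμ⟩ := admissible_of_discr_mod_eight p hK' hd8 h4 hp2 hHp
  obtain ⟨hDiv, hVal⟩ := hField W p hX hp5 hsurj K hK' hd8 hB' hHS hHN hHp hLt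
  exact ⟨K, inferInstance, inferInstance, hK', hodd, hpd, hμ, hHN, hLt, hDiv, hVal⟩

end Summit.BirchSwinnertonDyer.Rank1Residual.X11b

end
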